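import Summits.BirchSwinnertonDyer.BirchSwinnertonDyer.Theorems.BiquadraticEisensteinDescentEisensteinDivisibilityCMInertBadFlatAtOneAbsIrr
import HarnessLib

set_option linter.dupNamespace false -- `Summit.BirchSwinnertonDyer.BirchSwinnertonDyer.Theorems.…` (summit = sub)
set_option autoImplicit false

/-!
# Crux `InertBadAtThree` (stmt-BirchSwinnertonDyer-19225), line `rubin_e1_inert_three` v7 — the (Irr) binder of Hsieh's Thm B AT
# EVERY ODD PRIME: `E[p]|_{Γ_{K′}}` is absolutely irreducible for a CM curve `E/ℚ`, an ODD prime `p` inert in the CM field with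
# `p ∣ N_E`, and ANY imaginary quadratic `K′` satisfying the Heegner hypothesis for `N_E`

Lead-prover seat `bsd-line-ibd-p1` g8 (cell `pub/bsd-wall`, LINE mode on crux 19225). Route `BiquadraticEisensteinDescent`'s landed
support theorem `…EisensteinDivisibilityCMInertBadFlatAtOneAbsIrr.absIrrModPBaseChangeCMInert` (bsd-wall-bed-p2 g7, p526727) states
the (Irr) binder with `5 ≤ p`, but its proof — the two-Frobenius criterion inside `Γ_{K′}` (tools `…FlatAtOneAbsIrrTools`) — uses
`5 ≤ p` ONLY through `p ≠ 2` (`2 ≠ 0` in `𝔽_p`). THIS FILE records the proof at its natural generality `p ≠ 2`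
(`absIrrModPBaseChangeCMInert_of_ne_two`, proof VERBATIM with the binder weakened) and the `p = 3` instance
(`absIrrModPBaseChangeCMInert_three`) consumed by the `p = 3` heart of crux `InertBadAtThree`: the ♭-heart → (E_K′@3) composition
(`…InertBadAtThreeHeartOfHeartFlat`) needs exactly this input to read the unit content of a ♭-frame off Hsieh's Thm B.

THEOREMS ONLY (no definition, no named fact, no `sorry`); every input is a PROVED theorem of the tree; UNCONDITIONAL. Supports, does not
close, stmt-BirchSwinnertonDyer-19225. BSD is not proved by any of this.

References: [DiamondShurman2005] Thm. 9.4.1; [Lang1987] Ch. 13 §4 Thm. 12 (Deuring); [Hsieh2014] Thm. B hypothesis (2) (Doc. Math. 19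
p. 712); [Mazur1978] §6 Prop. 6.3 (1); [Cox2013] Lemma 1.14.
-/

noncomputable section

open scoped Matrix NumberField NumberTheorySymbols
open Polynomial Module IsDedekindDomain WeierstrassCurve NumberField
  Literature.NumberTheory.EllipticCurves Literature.NumberTheory.EllipticCurves.Rank1Residual
  Literature.NumberTheory.GaloisRepresentations
  Literature.NumberTheory.QuadraticFields.Quadratic
  Summit.BirchSwinnertonDyer.Rank1Residual
  Summit.BirchSwinnertonDyer.BirchSwinnertonDyer.Theorems.BiquadraticEisensteinDescentEisensteinDivisibilityCMInertBadFlatAtOneAbsIrrTools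
  Summit.BirchSwinnertonDyer.BirchSwinnertonDyer.Theorems.BiquadraticEisensteinDescentEisensteinDivisibilityCMInertBadFlatAtOneAbsIrr

namespace Summit.BirchSwinnertonDyer.BirchSwinnertonDyer.Theorems.InertBadSignedBranchesInertBadAtThreeHeartAbsIrr

/-- **(Irr) at every odd prime — the assembly of `…FlatAtOneAbsIrr.absIrrModPBaseChangeCMInert` with `5 ≤ p` weakened to `p ≠ 2`.**
For `W/ℚ` with complex multiplication, an odd prime `p` inert in the CM field (`CMInert W p`) and bad for `W`, and ANY imaginary
quadratic `K′` satisfying the Heegner hypothesis for `N_W`, every `𝔽_p`-framing `ρ̄` of `W_{K′}[p]` as a `Γ_{K′}`-representation is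
absolutely irreducible. Proof VERBATIM p526727: with `d = d_{K_CM}` and `d′ = d_{K′}`, `(d/p) = −1`, `(d′/p) = +1` (the bad `p ∣ N_W` splits
in `K′`), two Dirichlet primes `ℓ₃ ≡ −1`, `ℓ₁ ≡ −x (mod p)` (`x` a non-residue) inert in `K_CM` and split in `K′`, Deuring `a_ℓ = 0` on the
maximal-order model, Frobenius elements of `Γ_{K′}` with characteristic polynomials `X² − 1`, `X² − x`, and the two-Frobenius criterion
(`isAbsolutelyIrreducible_of_charpoly`, which needs only `2 ≠ 0` in `𝔽_p`). The binders `[NeZero (W.conductorNorm ℤ)]`, `W.HasCM` are carried.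
[cite: Hsieh2014, Thm. B hypothesis (2) (Doc. Math. 19 p. 712)] [cite: Lang1987, Ch. 13 §4 Thm. 12 (PDF p. 140)]
[cite: DiamondShurman2005, Thm. 9.4.1 (proof)] [cite: Cox2013, §1.C Lemma 1.14] -/
theorem absIrrModPBaseChangeCMInert_of_ne_two :
    ∀ (W : WeierstrassCurve ℚ) [W.IsElliptic] [W.IsGloballyMinimal] (p : ℕ) [Fact p.Prime]
      [NeZero (W.conductorNorm ℤ)], W.HasCM → p ≠ 2 → CMInert W p → ¬ Good W p →
      ∀ (K : Type) [Field K] [NumberField K], IsImaginaryQuadratic K →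
        SatisfiesHeegnerHypothesis (W.conductorNorm ℤ) K →
        ∀ ρ : ModPGaloisRep K (ZMod p) 2, (W.baseChange K).IsTorsionGaloisRep p ρ →
          FramedRep.IsAbsolutelyIrreducible ρ := by
  intro W _ _ p _ _ _hCM hp2 hin hbad K _ _ hK hHN ρ hρ
  have hp : p.Prime := Fact.out
  -- the CM field discriminant `d`: `p ∤ d`, `(d/p) = −1`
  set d : ℤ := cmFieldDiscrOfJ W.j with hd
  have hpd : ¬ (p : ℤ) ∣ d := hin.1
  have hd0 : d ≠ 0 := fun h ↦ hpd (by rw [h]; exact dvd_zero _)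
  have hns : ¬ IsSquare ((d : ℤ) : ZMod p) := fun hsq ↦ hin.2 ⟨hpd, by rw [if_neg hp2]; exact hsq⟩
  have hJd : J(d | p) = -1 := by
    rw [← jacobiSym.legendreSym.to_jacobiSym, legendreSym.eq_neg_one_iff]
    exact hns
  -- `p ∣ N` splits in `K`: `(d_K/p) = 1`, `p ∤ d_K`
  have hpN : p ∣ W.conductorNorm ℤ := (W.dvd_conductorNorm_iff_not_hasGoodReductionAtPrime p).mpr hbad
  have hJK : J(NumberField.discr K | p) = 1 := by
    rw [← jacobiSym.legendreSym.to_jacobiSym]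
    exact (ncard_primesOver_eq_two_iff_legendreSym hK.1 hp2).mp (hHN p hp hpN)
  have hpdK : ¬ (p : ℤ) ∣ NumberField.discr K := by
    intro h
    have h0 : legendreSym p (NumberField.discr K) = 0 :=
      (legendreSym.eq_zero_iff p _).mpr ((ZMod.intCast_zmod_eq_zero_iff_dvd _ p).mpr h)
    rw [← jacobiSym.legendreSym.to_jacobiSym, h0] at hJK
    exact zero_ne_one hJK
  have hdK0 : NumberField.discr K ≠ 0 := fun h ↦ hpdK (by rw [h]; exact dvd_zero _)
  have hdK4 := discr_emod_four_of_finrank_eq_two hK.1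
  -- the isogenous curve `W₁` with CM by the maximal order of the same field; `d ≡ 0, 1 (mod 4)`
  obtain ⟨W₁, hE₁, hmin₁, hiso, hj₁, hd₁⟩ :=
    X12.exists_isGloballyMinimal_isIsogenous_maximal_cmFieldDiscr_eq W
      (X12.mem_cmJInvariants_of_cmFieldDiscrOfJ_ne_zero hd0)
  haveI := hE₁
  haveI := hmin₁
  have hd4 : d % 4 = 0 ∨ d % 4 = 1 := by
    rw [hd, ← hd₁]
    exact cmFieldDiscr_emod_four hj₁
  -- a non-residue `x` mod `p`
  obtain ⟨x, hx⟩ := FiniteField.exists_nonsquare (F := ZMod p) (by rw [ZMod.ringChar_zmod_n]; exact hp2)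
  have hx0 : x ≠ 0 := fun h ↦ hx (by rw [h]; exact IsSquare.zero)
  -- the auxiliary primes: from `(d/ℓ) = −1`, `(d_K/ℓ) = 1`, `ℓ` large, read off `a_ℓ(W) = 0`, `ℓ` split, `ℓ` good
  set n : ℕ := max (minimalDiscriminantInt W).natAbs (minimalDiscriminantInt W₁).natAbs with hn
  have aux : ∀ {ℓ : ℕ}, ℓ.Prime → n < ℓ → p < ℓ → ¬ (ℓ : ℤ) ∣ d → J(d | ℓ) = J(d | p) →
      J(NumberField.discr K | ℓ) = J(NumberField.discr K | p) →
      W.frobeniusTrace ℓ = 0 ∧ ((Ideal.span {(ℓ : ℤ)}).primesOver (𝓞 K)).ncard = 2 ∧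
        ¬ (ℓ : ℤ) ∣ minimalDiscriminantInt W ∧ ℓ ≠ p := by
    intro ℓ hℓ hnℓ hpℓ hℓd hJℓd hJℓK
    haveI : Fact ℓ.Prime := ⟨hℓ⟩
    have hℓ2 : ℓ ≠ 2 := by
      have := hp.two_le
      omega
    rw [hn, max_lt_iff] at hnℓ
    have hℓΔ : ¬ (ℓ : ℤ) ∣ minimalDiscriminantInt W :=
      X12.natCast_not_dvd_of_natAbs_lt (minimalDiscriminantInt_ne_zero W) hnℓ.1
    have hℓΔ₁ : ¬ (ℓ : ℤ) ∣ minimalDiscriminantInt W₁ :=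
      X12.natCast_not_dvd_of_natAbs_lt (minimalDiscriminantInt_ne_zero W₁) hnℓ.2
    -- Deuring on `W₁`: `a_ℓ(W₁) = 0`
    have hℓd2 : ¬ (ℓ : ℤ) ∣ 2 * cmFieldDiscr W₁.j := by
      rw [hd₁, ← hd]
      intro h
      rcases (Nat.prime_iff_prime_int.mp hℓ).dvd_or_dvd h with h2 | h2
      · exact hℓ2 ((Nat.prime_dvd_prime_iff_eq hℓ Nat.prime_two).mp (by exact_mod_cast h2))
      · exact hℓd h2
    have hinert : legendreSym ℓ (cmFieldDiscr W₁.j) = -1 := by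
      rw [hd₁, ← hd, jacobiSym.legendreSym.to_jacobiSym, hJℓd, hJd]
    have ha₁ : W₁.frobeniusTrace ℓ = 0 :=
      X12.frobeniusTrace_eq_zero_of_legendreSym_cmFieldDiscr_eq_neg_one W₁ hj₁ ℓ hℓd2 hℓΔ₁ hinert
    have ha : W.frobeniusTrace ℓ = 0 := by
      rw [frobeniusTrace_eq_of_isIsogenous hiso ℓ (hasGoodReductionAtPrime_of_not_dvd W ℓ hℓΔ)
        (hasGoodReductionAtPrime_of_not_dvd W₁ ℓ hℓΔ₁), ha₁]
    -- `ℓ` splits in `K`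
    have hsplit : ((Ideal.span {(ℓ : ℤ)}).primesOver (𝓞 K)).ncard = 2 := by
      refine (ncard_primesOver_eq_two_iff_legendreSym hK.1 hℓ2).mpr ?_
      rw [jacobiSym.legendreSym.to_jacobiSym, hJℓK, hJK]
    exact ⟨ha, hsplit, hℓΔ, by omega⟩
  -- `ℓ₃ ≡ −1 (mod p)` and `ℓ₁ ≡ −x (mod p)`
  obtain ⟨ℓ₃, hℓ₃, hnℓ₃, hpℓ₃, hℓ₃d, -, hℓ₃c, hJ₃d, hJ₃K⟩ := exists_prime_jacobiSym_eq_jacobiSym hd0 hd4 hdK0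
    hdK4 hp hp2 hpd hpdK (c := (-1 : ZMod p)) (neg_ne_zero.mpr one_ne_zero) n
  obtain ⟨ℓ₁, hℓ₁, hnℓ₁, hpℓ₁, hℓ₁d, -, hℓ₁c, hJ₁d, hJ₁K⟩ := exists_prime_jacobiSym_eq_jacobiSym hd0 hd4 hdK0
    hdK4 hp hp2 hpd hpdK (c := -x) (neg_ne_zero.mpr hx0) n
  obtain ⟨ha₃, hsplit₃, hΔ₃, hne₃⟩ := aux hℓ₃ hnℓ₃ hpℓ₃ hℓ₃d hJ₃d hJ₃K
  obtain ⟨ha₁', hsplit₁, hΔ₁, hne₁⟩ := aux hℓ₁ hnℓ₁ hpℓ₁ hℓ₁d hJ₁d hJ₁K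
  -- the two Frobenius elements of `Γ_K`
  obtain ⟨σ₃, hσ₃⟩ := exists_charpoly_eq_of_split W p K hK.1 hρ hℓ₃ hne₃ hΔ₃ hsplit₃
  obtain ⟨σ₁, hσ₁⟩ := exists_charpoly_eq_of_split W p K hK.1 hρ hℓ₁ hne₁ hΔ₁ hsplit₁
  rw [ha₃, Int.cast_zero, hℓ₃c] at hσ₃
  rw [ha₁', Int.cast_zero, hℓ₁c] at hσ₁
  -- the two-Frobenius criterion
  have h2 : (2 : ZMod p) ≠ 0 := two_ne_zero_zmod hp2
  exact isAbsolutelyIrreducible_of_charpoly ρ h2 hσ₃ hσ₁ hx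

/-- **(Irr) at `p = 3`** — the instance consumed by the `p = 3` heart of crux `InertBadAtThree` (line `rubin_e1_inert_three` v7): for
`W/ℚ` CM with `3` CM-inert and bad and any imaginary quadratic Heegner field `K′` for `N_W`, every `𝔽₃`-framing of `W_{K′}[3]|_{Γ_{K′}}`
is absolutely irreducible (the image of `Γ_{K′}` contains an element of the non-split Cartan of order `4`, eigenvalues `±i ∈ 𝔽₉`, and
an element of the other coset of its normaliser). [cite: Hsieh2014, Thm. B hypothesis (2) (Doc. Math. 19 p. 712)] -/
theorem absIrrModPBaseChangeCMInert_three :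
    ∀ (W : WeierstrassCurve ℚ) [W.IsElliptic] [W.IsGloballyMinimal] (p : ℕ) [Fact p.Prime]
      [NeZero (W.conductorNorm ℤ)], W.HasCM → p = 3 → CMInert W p → ¬ Good W p →
      ∀ (K : Type) [Field K] [NumberField K], IsImaginaryQuadratic K →
        SatisfiesHeegnerHypothesis (W.conductorNorm ℤ) K →
        ∀ ρ : ModPGaloisRep K (ZMod p) 2, (W.baseChange K).IsTorsionGaloisRep p ρ →
          FramedRep.IsAbsolutelyIrreducible ρ :=
  fun W _ _ p _ _ hCM hp3 hin hbad K _ _ hK hHN ρ hρ ↦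
    absIrrModPBaseChangeCMInert_of_ne_two W p hCM (by omega) hin hbad K hK hHN ρ hρ

end Summit.BirchSwinnertonDyer.BirchSwinnertonDyer.Theorems.InertBadSignedBranchesInertBadAtThreeHeartAbsIrr

end
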